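import Summits.CriticalPhenomena.CardyFormulaZ2.Theorems.CardyComplexConeParafermionToSLESixFamiliesDefs
import Summits.CriticalPhenomena.CardyFormulaZ2.Theorems.CardyComplexConeParafermionToSLESixFamiliesPercDomainMarkov
import HarnessLib

/-!
# The slit bridge of step (4a): percolation slit expectations are pinned-edge observables, and no admissible `DiscreteDobrushin` datum renders them

Route `CardyComplexCone` (sub-problem `CriticalPhenomena/CardyFormulaZ2`), crux
`Summit.CriticalPhenomena.CardyFormulaZ2.Theses.CardyComplexCone.ParafermionToSLESixFamilies`
(item stmt-CriticalPhenomena-11389), line `caratheodory-net-slit-uniformity`, stub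
`stub_percParaApprox : IdentifiedLimit → CarrierEquicontinuity' → UniformPrecompact → PercParaApprox`,
internal step (4a) "identify the percolation slit expectation `percSlitExpectation` (the exact
discrete martingale `n ↦ E[X_z | 𝓕_n]` of `…PercDomainMarkov.lean`) with the observable of an
admissible slit datum". This file settles what (4a) can and cannot be for the tree's objects.

**§1 The exact bridge (pinned-edge rendering).** Freezing the revealed free edges `R` of the
prefix event `C_n(ω₀)` to their `ω₀`-states is PINNING: `freeze hE ω₀ n ω = (ω ∪ O) \ C` with
`O = ω₀ ∩ R` (revealed open = followed edges, the wired side of the slit) and `C = R \ ω₀`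
(revealed closed = crossed edges, the dual-wired side) (`freeze_eq_pin`), so that
`percSlitExpectation hE p n g ω₀ = ∫ g ((ω ∪ O) \ C) dP_p(ω)` (`percSlitExpectation_eq_integral_pin`;
for the crux's integrand, `percSlitExpectation_passageSum_eq_integral_pin`). The completed
configuration of a pinned configuration is the pinned completed configuration,
`E.bcBondConfig ((ω ∪ O) \ C) = (E.bcBondConfig ω ∪ O) \ C` for `O, C` free
(`bcBondConfig_pin`, `bcBondConfig_freeze`): conditionally on `𝓕_n`, the model IS critical bond
percolation on the graph `Ω_δ` with the EDGE-WISE Dobrushin boundary conditions "`A`–`A` edges and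
`O` open, edges at `B` and `C` closed", explored from the same start edge `e_a`; the frozen
exploration extends the prefix (`freeze_mem_explorationCylinder`, `explorationPrefix_freeze`).
The class of pinned data `(E, O, C)` (`E` admissible, `O, C ⊆` free edges of `E`) contains the
admissible data (`O = C = ∅`) and is closed under slitting; it is the class over which a slit
identification can be stated.

**§2 The no-go for `DiscreteDobrushin` renderings.** In the tree's (H21) rendering of Dobrushin
boundary conditions (`DiscreteDobrushin.bcBondConfig`, `MedialInterface.lean`) an edge of `Ω_δ`
that is closed in EVERY completed configuration has an endpoint on the dual-wired arc `zdArcB`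
(`exists_mem_zdArcB_of_forall_not_mem_bcBondConfig`), and every edge at such an endpoint is then
closed for every configuration (`not_mem_bcBondConfig_of_mem_zdArcB`): the rendering can force a
single edge closed only by killing one of its endpoints (or by deleting it from `Ω_δ`, which
kills its two faces). Free edges are exactly the genuinely random ones (`isFreeEdge_iff_exists`).
Hence (`not_isZdAdmissible_rendering_of_pin`): if a pinned-closed edge `e ∈ C` has at each endpoint
another free edge of `E` not in `C`, NO admissible datum `E'` on any carrier with `e ∈ Ω'_δ` has
`E'.bcBondConfig = ((E.bcBondConfig ·) ∪ O) \ C`. Along a percolation exploration this is the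
typical situation, not a degenerate one: a crossed edge `{v, u}` (left vertex `v`, wired side)
whose right endpoint `u` is later a left vertex itself — the exploration enters a pocket of the
dual cluster through the dual edge of `{v, u}` and leaves it through the same dual edge, passing
the medial vertex `{v, u}` twice, once around `v` and once around `u` (the square-lattice form of
"the same hexagon visited twice"). Numerics (three-sided `W × W` boxes, `A` = left/top/right,
`B` = bottom row, uniform `ω`, 100–400 samples; `work/stubs/scratch2/explore.py` of the session):
fraction of explorations with a doubly visited medial vertex `0.97 / 1.00 / 1.00 / 1.00` for
`W = 6 / 10 / 20 / 40`; mean number of medial vertices crossed twice per exploration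
`11.1 / 26.6 / 89.0 / 341.4` out of `69.6 / 165.0 / 542.1 / 2037.1` steps (one step in six).
The nearest ADMISSIBLE approximant of the conditional model (left vertices of the prefix wired into
`A'`, right endpoints of crossed edges killed into `B'`, revealed-closed `A'`–`A'` edges deleted)
has, given a prefix of half the exploration, a different continuation with conditional
probability `0.78–0.89`, and its conditional spin-`1/3` amplitude `m'` at a bulk edge at distance
`≥ W/6` from the prefix differs from the true conditional amplitude `m` by
`|m - m'| = 0.22 / 0.30 / 0.16 / 0.11` against `|m| = 0.64 / 0.52 / 0.37 / 0.29`
(`W = 10 / 20 / 40 / 60`; `24 / 20 / 43 / 8` prefixes × `200 / 200 / 80 / 60` coupled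
continuations; `explore2.py`–`explore4.py`): no decay is visible at these sizes, so an approximate
bridge through admissible data is itself a statement of research strength, not bookkeeping.
Consequently the line's hypotheses `IdentifiedLimit`, `CarrierEquicontinuity'`,
`UniformPrecompact` — statements about `obs`/`aobs` of ADMISSIBLE `DiscreteDobrushin` data only —
never meet `percSlitExpectation_n` for `n ≥ 1` as an identity; step (4a) as planned ("aobs of an
admissible fattened-slit datum") does not exist in this rendering, for any fattening (removing
closed cells deletes the live left vertices, removing open cells or zero-width slits is invisible
to `meshGraph`, removing the crossed edges kills the two faces the exploration re-enters).

**§3 Orientation and reversibility.** The exploration starts at the `A`–`B` edge `e_a` at which,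
facing into the domain, the wired arc is on the LEFT (`IsMedialExploration.start`); walking the
boundary of the face domain counter-clockwise (domain on the left) from `e_a` therefore runs along
the arc `B` first. A discretisation family has `arcA → D.arc 0`, the arc from `D.pt 0` to `D.pt 1`
in the direction of the boundary parametrisation; so for a COUNTER-CLOCKWISE parametrised Jordan
domain (e.g. `JordanDomain.unitDisc`, `circleMap`) the start edges `e_a` accumulate at `D.pt 1 = b`:
the exploration runs from `b` to `a` and `bondInterfaceIn` REVERSES it, while for clockwise `D` it
runs from `a` to `b`. The forward machinery (`explorationFiltration`, `percSlitExpectation`, the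
orientation hypothesis `dist (e_a) (D.pt 0) ≤ dist (e_a) (D.pt 1)` of `…PercDrivingLocality.lean`)
covers the clockwise case only; `PercParaApprox` quantifies over all `D`. The counter-clockwise
case needs the filtration of the REVERSED exploration, and the pinned bridge holds for it too,
because the turning rule is deterministic backwards as well: the predecessor of a corner is read
off the status of its SOURCE edge (the tree's `prevCorner` / `cornerPerm`,
`Literature/Probability/LatticeModels/CornerPermutation.lean`: `nextCorner β` is a permutation of
the coded corners), so the event "the last `m` steps are prescribed" is again a cylinder over the
free edges those steps reveal, off which the configuration is again i.i.d. — conditionally on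
either end of the interface the model is a pinned datum `(E, O, C)`; the mirrored
`…PercDomainMarkov.lean` (suffix cylinders, reversed exploration filtration) is not written.

What a reshape needs (recorded for the lead, nothing asserted here): restate the three
hypotheses over pinned data `(E, O, C)` — the observable
`∫ passageSum (medialExploration E ((ω ∪ O) \ C)) E.δ (1/3) z dPc(ω)` of §1 —, or take the slit
identification along explorations itself as the line's research stub.
-/

noncomputable section

open scoped Topology NNReal ENNReal
open Filter Set MeasureTheory
open Literature.Probability Literature.Probability.LatticeModels Literature.Probability.Percolation
open Literature.Probability.LatticeModels.DiscreteDobrushin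

namespace Summit.CriticalPhenomena.CardyFormulaZ2.Cruxes.ParafermionToSLESixFamilies.CaratheodoryNetSlitUniformity

variable {E : DiscreteDobrushin}

/-! ### §1 Freezing is pinning: the exact bridge -/

/-- Revealed free edges are free edges of the datum. -/
theorem isFreeEdge_of_mem_revealedFreeEdges {hE : E.IsZdAdmissible} {ω₀ : BondConfig (Site 2)}
    {n : ℕ} {e : Sym2 (Site 2)} (he : e ∈ revealedFreeEdges hE ω₀ n) : E.IsFreeEdge e := by
  obtain ⟨_, -, -, hf⟩ := he
  exact hf

/-- **Freezing is pinning.** The configuration frozen to `ω₀` on the revealed free edges `R` of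
`C_n(ω₀)` is `ω` with the revealed open edges `ω₀ ∩ R` added and the revealed closed edges
`R \ ω₀` removed. -/
theorem freeze_eq_pin (hE : E.IsZdAdmissible) (ω₀ : BondConfig (Site 2)) (n : ℕ)
    (ω : BondConfig (Site 2)) :
    freeze hE ω₀ n ω = (ω ∪ (ω₀ ∩ revealedFreeEdges hE ω₀ n)) \
      (revealedFreeEdges hE ω₀ n \ ω₀) := by
  ext e
  simp only [freeze, Set.mem_union, Set.mem_sdiff, Set.mem_inter_iff]
  tauto

/-- **The percolation slit expectation is the expectation of the pinned configuration**
(definitional form of the bridge of step (4a), any integrand). -/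
theorem percSlitExpectation_eq_integral_pin : ∀ {E : DiscreteDobrushin} (hE : E.IsZdAdmissible) (p : unitInterval) (n : ℕ) {F : Type*} [NormedAddCommGroup F] [NormedSpace ℝ F] (g : BondConfig (Site 2) → F) (ω₀ : BondConfig (Site 2)), percSlitExpectation hE p n g ω₀ = ∫ ω, g ((ω ∪ (ω₀ ∩ revealedFreeEdges hE ω₀ n)) \ (revealedFreeEdges hE ω₀ n \ ω₀)) ∂bondPercolation (zdGraph 2) p := by
  intro E hE p n F _ _ g ω₀
  simp only [percSlitExpectation, freeze_eq_pin]

/-- **The exact discrete martingale of the spin-`σ` parafermion is a pinned-edge observable.**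
For the crux's integrand `X_z(ω) = ∑_{passages of γ(ω) through z} e^{-iσW}`, the slit expectation
at depth `n` — a.e. the conditional expectation `Pc[X_z | 𝓕_n]`
(`condExp_explorationFiltration_ae_eq_percSlitExpectation`) — is the `Pc`-expectation of the
twisted passage sum of the exploration of `E` in the configuration pinned open on the revealed
followed edges and pinned closed on the revealed crossed edges: the observable of the pinned datum
`(E, ω₀ ∩ R, R \ ω₀)`, explored from the same start edge `e_a` with the same winding base. At
`n = 0` (`R = ∅`) this is `obs E z` (`percSlitExpectation_zero`). -/
theorem percSlitExpectation_passageSum_eq_integral_pin : ∀ {E : DiscreteDobrushin} (hE : E.IsZdAdmissible) (σ : ℝ) (z : MedialVertex) (n : ℕ) (ω₀ : BondConfig (Site 2)), percSlitExpectation hE half n (fun ω ↦ MedialPath.passageSum (medialExploration E ω) E.δ σ z) ω₀ = ∫ ω, MedialPath.passageSum (medialExploration E ((ω ∪ (ω₀ ∩ revealedFreeEdges hE ω₀ n)) \ (revealedFreeEdges hE ω₀ n \ ω₀))) E.δ σ z ∂Pc := by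
  intro E hE σ z n ω₀
  exact percSlitExpectation_eq_integral_pin hE half n _ ω₀

/-- **The completed configuration of a pinned configuration is the pinned completed
configuration**, for pinning sets of free edges: pinning commutes with the Dobrushin boundary
condition. In words: conditionally on the prefix, the model is bond percolation on `Ω_δ` with the
edge-wise Dobrushin boundary conditions "wired `A`–`A` edges and `O` open, edges at `B` and `C`
closed". -/
theorem bcBondConfig_pin : ∀ {E : DiscreteDobrushin} {O C : Set (Sym2 (Site 2))}, (∀ e ∈ O, E.IsFreeEdge e) → (∀ e ∈ C, E.IsFreeEdge e) → ∀ ω : BondConfig (Site 2), E.bcBondConfig ((ω ∪ O) \ C) = (E.bcBondConfig ω ∪ O) \ C := by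
  intro E O C hO hC ω
  ext e
  by_cases heC : e ∈ C
  · rw [mem_bcBondConfig_iff_of_isFreeEdge (hC e heC)]
    simp [heC]
  · by_cases heO : e ∈ O
    · rw [mem_bcBondConfig_iff_of_isFreeEdge (hO e heO)]
      simp [heC, heO]
    · simp only [DiscreteDobrushin.mem_bcBondConfig_iff, Set.mem_sdiff, Set.mem_union, heO, heC,
        or_false, not_false_eq_true, and_true]

/-- The completed frozen configuration is the pinned completed configuration. -/
theorem bcBondConfig_freeze (hE : E.IsZdAdmissible) (ω₀ : BondConfig (Site 2)) (n : ℕ)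
    (ω : BondConfig (Site 2)) :
    E.bcBondConfig (freeze hE ω₀ n ω) = (E.bcBondConfig ω ∪ (ω₀ ∩ revealedFreeEdges hE ω₀ n)) \
      (revealedFreeEdges hE ω₀ n \ ω₀) := by
  rw [freeze_eq_pin]
  exact bcBondConfig_pin (fun e he ↦ isFreeEdge_of_mem_revealedFreeEdges he.2)
    (fun e he ↦ isFreeEdge_of_mem_revealedFreeEdges he.1) ω

/-- **The frozen exploration extends the prefix**: every frozen configuration lies in the prefix
event `C_n(ω₀)`. -/
theorem freeze_mem_explorationCylinder (hE : E.IsZdAdmissible) (ω₀ : BondConfig (Site 2)) (n : ℕ)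
    (ω : BondConfig (Site 2)) : freeze hE ω₀ n ω ∈ explorationCylinder hE ω₀ n := by
  rw [explorationCylinder_eq_setOf_revealedFreeEdges]
  intro e he
  simp only [freeze, Set.mem_union, Set.mem_sdiff, Set.mem_inter_iff]
  exact ⟨fun h ↦ h.elim (fun h ↦ absurd he h.2) And.left, fun h ↦ Or.inr ⟨h, he⟩⟩

/-- The exploration of a frozen configuration has the same first `n + 2` medial vertices as that
of `ω₀`: the slit expectation integrates over CONTINUATIONS of `γ[0, n+1]`. -/
theorem explorationPrefix_freeze (hE : E.IsZdAdmissible) (ω₀ : BondConfig (Site 2)) (n : ℕ)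
    (ω : BondConfig (Site 2)) :
    explorationPrefix E n (freeze hE ω₀ n ω) = explorationPrefix E n ω₀ :=
  mem_explorationCylinder_iff_take.1 (freeze_mem_explorationCylinder hE ω₀ n ω)

/-- Pinning is measurable (product σ-algebra). -/
theorem measurable_pin (O C : Set (Sym2 (Site 2))) :
    Measurable fun ω : BondConfig (Site 2) ↦ (ω ∪ O) \ C :=
  measurable_set_iff.2 fun e ↦ ((measurable_set_mem e).or measurable_const).and measurable_const

/-- **The exploration of a pinned configuration is the cut orbit of the pinned completed
configuration**: pinned data `(E, O, C)` are explored by the tree's medial exploration of `E`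
itself (same start corner, same turning rule, same exit rule), run on the completed configuration
with `O` forced open and `C` forced closed — so the whole exploration theory of
`MedialInterfaceProofs.lean` (well-definedness, left-vertex invariant, exit analysis,
measurability, the bound `‖passageSum‖ ≤ 2`) applies to pinned data verbatim. -/
theorem medialExploration_pin_eq_explorationList (hE : E.IsZdAdmissible) {O C : Set (Sym2 (Site 2))}
    (hO : ∀ e ∈ O, E.IsFreeEdge e) (hC : ∀ e ∈ C, E.IsFreeEdge e) (ω : BondConfig (Site 2)) :
    medialExploration E ((ω ∪ O) \ C) =
      explorationList ((E.bcBondConfig ω ∪ O) \ C) (startCorner hE) (exitTime hE ((ω ∪ O) \ C)) := by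
  rw [medialExploration_eq_explorationList hE, bcBondConfig_pin hO hC]

/-- Pinning twice is pinning once (closure of pinned data under slitting), provided the second
open set avoids the first closed set. -/
theorem pin_pin {O₁ C₁ O₂ C₂ : Set (Sym2 (Site 2))} (h : Disjoint O₂ C₁) (ω : BondConfig (Site 2)) :
    ((ω ∪ O₁) \ C₁ ∪ O₂) \ C₂ = (ω ∪ (O₁ ∪ O₂)) \ (C₁ ∪ C₂) := by
  ext e
  simp only [Set.mem_sdiff, Set.mem_union]
  have := fun (h1 : e ∈ O₂) (h2 : e ∈ C₁) ↦ Set.disjoint_left.1 h h1 h2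
  tauto

/-! ### §2 No admissible `DiscreteDobrushin` datum renders a pinned-closed live edge -/

/-- **An edge of `Ω_δ` closed in every completed configuration has an endpoint on the dual-wired
arc `B`** (test the configuration `{e}`). -/
theorem exists_mem_zdArcB_of_forall_not_mem_bcBondConfig {E' : DiscreteDobrushin}
    {e : Sym2 (Site 2)} (he : e ∈ (discreteDomainGraph E'.Ω E'.δ).edgeSet)
    (h : ∀ ω, e ∉ E'.bcBondConfig ω) : ∃ x ∈ e, x ∈ E'.zdArcB := by
  by_contra hB
  push Not at hB
  exact h {e} ⟨he, Or.inr ⟨Set.mem_singleton e, hB⟩⟩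

/-- **An edge of `Ω_δ` open in every completed configuration is a wired `A`–`A` edge** (test the
empty configuration). -/
theorem forall_mem_zdArcA_of_forall_mem_bcBondConfig {E' : DiscreteDobrushin} {e : Sym2 (Site 2)}
    (h : ∀ ω, e ∈ E'.bcBondConfig ω) : ∀ x ∈ e, x ∈ E'.zdArcA := by
  obtain ⟨-, hA | ⟨hω, -⟩⟩ := h ∅
  · exact hA
  · exact absurd hω (Set.notMem_empty e)

/-- **Free edges are exactly the genuinely random edges**: for admissible data, an edge is free
iff it is an edge of `Ω_δ` that is open in some completed configuration and closed in another. -/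
theorem isFreeEdge_iff_exists {E' : DiscreteDobrushin} (hE' : E'.IsZdAdmissible)
    {e : Sym2 (Site 2)} :
    E'.IsFreeEdge e ↔ e ∈ (discreteDomainGraph E'.Ω E'.δ).edgeSet ∧
      (∃ ω, e ∈ E'.bcBondConfig ω) ∧ ∃ ω, e ∉ E'.bcBondConfig ω := by
  constructor
  · intro hf
    refine ⟨hf.1, ⟨{e}, (mem_bcBondConfig_iff_of_isFreeEdge hf _).2 (Set.mem_singleton e)⟩,
      ⟨∅, fun h ↦ ?_⟩⟩
    exact Set.notMem_empty e ((mem_bcBondConfig_iff_of_isFreeEdge hf _).1 h)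
  · rintro ⟨he, ⟨ω₁, h₁⟩, ⟨ω₂, h₂⟩⟩
    refine ⟨he, fun x hx hxB ↦ not_mem_bcBondConfig_of_mem_zdArcB hE' hx hxB h₁, fun hA ↦ h₂ ?_⟩
    exact mem_bcBondConfig_of_arcA he hA

/-- **No-go: the H21 rendering cannot pin a live edge closed.** Let `E'` be admissible Dobrushin
data (any carrier, mesh and arcs) whose completed configurations are those of `E` pinned open on
`O` and closed on `C`, and let `e ∈ C` be an edge of `Ω'_δ` (so that its two faces can be inner
in `E'`) each endpoint of which carries another free edge of `E` outside `C`. Contradiction: `e`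
is closed in every completed configuration of `E'`, so one endpoint `x` lies on `E'.zdArcB`, so
the free edge `e'` at `x` is closed in `E'` for every configuration — but it is open in `E`, hence
in `E'`, for the configuration `{e'}`. -/
theorem not_isZdAdmissible_rendering_of_pin : ∀ {E E' : DiscreteDobrushin} {O C : Set (Sym2 (Site 2))} {e : Sym2 (Site 2)}, E'.IsZdAdmissible → (∀ ω, E'.bcBondConfig ω = (E.bcBondConfig ω ∪ O) \ C) → e ∈ C → e ∈ (discreteDomainGraph E'.Ω E'.δ).edgeSet → (∀ x ∈ e, ∃ e' : Sym2 (Site 2), x ∈ e' ∧ e' ∉ C ∧ E.IsFreeEdge e') → False := by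
  intro E E' O C e hE' hbc heC he' hlive
  have hclosed : ∀ ω, e ∉ E'.bcBondConfig ω := fun ω h ↦ by
    rw [hbc ω] at h
    exact h.2 heC
  obtain ⟨x, hxe, hxB⟩ := exists_mem_zdArcB_of_forall_not_mem_bcBondConfig he' hclosed
  obtain ⟨e', hxe', he'C, hfree⟩ := hlive x hxe
  have h1 : e' ∈ E'.bcBondConfig {e'} := by
    rw [hbc]
    exact ⟨Or.inl ((mem_bcBondConfig_iff_of_isFreeEdge hfree _).2 (Set.mem_singleton e')), he'C⟩
  exact not_mem_bcBondConfig_of_mem_zdArcB hE' hxe' hxB h1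

/-- **No-go, exploration form.** If a revealed free edge `e` of the prefix event `C_n(ω₀)` is
closed in `ω₀` (a crossed edge) and each of its endpoints carries another free edge of `E` that is
not revealed-closed, then no admissible datum `E'` with `e ∈ Ω'_δ` has the frozen boundary
condition `E'.bcBondConfig = E.bcBondConfig ∘ freeze hE ω₀ n`. -/
theorem not_isZdAdmissible_rendering_of_freeze (hE : E.IsZdAdmissible) {E' : DiscreteDobrushin}
    (hE' : E'.IsZdAdmissible) {ω₀ : BondConfig (Site 2)} {n : ℕ}
    (hbc : ∀ ω, E'.bcBondConfig ω = E.bcBondConfig (freeze hE ω₀ n ω)) {e : Sym2 (Site 2)}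
    (heR : e ∈ revealedFreeEdges hE ω₀ n) (he₀ : e ∉ ω₀)
    (he' : e ∈ (discreteDomainGraph E'.Ω E'.δ).edgeSet)
    (hlive : ∀ x ∈ e, ∃ e' : Sym2 (Site 2), x ∈ e' ∧ ¬ (e' ∈ revealedFreeEdges hE ω₀ n ∧ e' ∉ ω₀) ∧
      E.IsFreeEdge e') : False := by
  have hbc' : ∀ ω, E'.bcBondConfig ω = (E.bcBondConfig ω ∪ (ω₀ ∩ revealedFreeEdges hE ω₀ n)) \
      (revealedFreeEdges hE ω₀ n \ ω₀) := fun ω ↦ by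
    rw [hbc ω, bcBondConfig_freeze]
  exact not_isZdAdmissible_rendering_of_pin (E := E) (E' := E') hE' hbc' ⟨heR, he₀⟩ he'
    (fun x hx ↦ by
      obtain ⟨e', h1, h2, h3⟩ := hlive x hx
      exact ⟨e', h1, h2, h3⟩)

end Summit.CriticalPhenomena.CardyFormulaZ2.Cruxes.ParafermionToSLESixFamilies.CaratheodoryNetSlitUniformity

end
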